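import Literature.MathematicalPhysics.QuantumManyBody.EliashbergTcCeiling
import Mathlib.Analysis.Real.Pi.Bounds

/-!
# A sharper ceiling for the Eliashberg `T_c`: `k_B T_c ≤ (√2/7) ħ (λ⟨ω²⟩)^{1/2} = 0.2020 (λ⟨ω²⟩)^{1/2}`

Sequel to `EliashbergTcCeiling` (`T_c ≤ (λ⟨ω²⟩/12)^{1/2} = 0.2887 (λ⟨ω²⟩)^{1/2}`). The same weighted
Collatz–Wielandt row test [cite: HornJohnson2013, Thm. 8.1.26, Cor. 8.1.29] is run with the two-level
weight `p_n = d_n^{1/2} w_n`, `w = (1, v, v, v, …)`, `v = 4/15`, instead of `p = d^{1/2}`: the row `n = 0`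
of the Toeplitz-plus-Hankel phonon matrix, which alone carried the full tail `2Σ_{k≥1} λ(k)` in the
unweighted test, is relieved by the factor `v` at the price of the single entry `Λ_{n0} = λ(n) + λ(n+1)`
in the rows `n ≥ 1`, and the two conditions balance at `v ≈ 0.26`. With `λ(k) ≤ A/(2πTk)²`
(`A = Σ_i λ_i ω_i² = λ⟨ω²⟩`) and `Σ_{k≥1} k^{-2} = π²/6`, `Σ_{k≥2} k^{-2} = π²/6 − 1`, both row conditions
hold as soon as `49 T² > 2A`; hence, for the full-line mass-renormalisation convention
(`d_n = 2n+1 + λ(0) + 2Σ_{k≤n} λ(k)`, the analytic `ω_n Z_n/πT` [cite: AllenDynes1975, Eqs. (9)–(12)]),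
every `μ* ≥ 0`, every cutoff and Matsubara count:

  `k_B T_c ≤ ħ (2λ⟨ω²⟩/49)^{1/2} = 0.20203 (λ⟨ω²⟩)^{1/2}`,

to be compared with the Allen–Dynes large-`λ` asymptote `0.1827 (λ⟨ω²⟩)^{1/2}`
[cite: AllenDynes1975, Eq. (26)] (ratio `1.106`; the ceiling of `EliashbergTcCeiling` has `1.58`, the
printed rigorous bound [cite: KiesslingAltshulerYuzbashyan2025II, Thm. 6] has `2.03`). The truncated-`Z`
convention is NOT covered by this sharper constant (its `d_0 = 1 + λ(0) − λ(N)` costs an extra `λ(N)` in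
row `0`, which at `N = 1` violates the bound); it keeps the `1/12` ceiling.

* `eigenvalues₀_max_lt_one_of_weightedRowDominance` — `Σ_m Λ_{nm} w_m < d_n w_n` for a positive weight
  `w` ⇒ `λ_max(S₀ − 2μssᵀ) < 1`;
* `sum_range_toeplitz_le_tail` — `Σ_{m<N} λ(|n−m|) ≤ λ(0) + 2Σ_{k=1}^{n} λ(k) + T_n` with `T_n` any bound of
  the partial sums of `λ(n+1), λ(n+2), …` (the row-`n` tail, not the full one);
* `weightedRow_zero_lt`, `weightedRow_succ_lt` — the two row conditions;
* `sum_range_inv_add_two_sq_le`, `sum_matsubaraCoupling_tail_le` — `Σ_{k≥2} k^{-2} ≤ π²/6 − 1` and the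
  row tails `≤ A/(24T²) − A/(4π²T²)`;
* `eliashbergTopEigenvalue_lt_one_sharp`, `eliashbergTc_le_sqrt_sharp` — assembly and threshold form.

## References
* [AllenDynes1975] P. B. Allen, R. C. Dynes, Phys. Rev. B 12 (1975) 905 — Eqs. (9)–(12), Eq. (26).
* [KiesslingAltshulerYuzbashyan2025II] M. K.-H. Kiessling, B. L. Altshuler, E. A. Yuzbashyan, J. Stat.
  Phys. 192 (2025), doi:10.1007/s10955-025-03468-z (arXiv:2409.00532) — Thm. 6.
* [HornJohnson2013] R. A. Horn, C. R. Johnson, *Matrix Analysis*, 2nd ed., CUP 2013 — Thm. 8.1.26,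
  Cor. 8.1.29.
-/

noncomputable section

open scoped Matrix

namespace Literature.MathematicalPhysics.QuantumManyBody

open Finset _root_.Matrix Literature.Analysis.Matrix Real

/-! ### Weighted row dominance -/

section Weighted

variable {N : ℕ}

/-- **Weighted row dominance makes the kernel subcritical.** As
`eigenvalues₀_max_lt_one_of_rowDominance`, with a positive weight `w`: if `Σ_m Λ_{nm} w_m < d_n w_n` for
every `n`, then `λ_max((Λ_{nm} − 2μ)/(d_n d_m)^{1/2}) < 1` for every `μ ≥ 0` (row test with
`p_n = d_n^{1/2} w_n`). [cite: HornJohnson2013, Cor. 8.1.29] -/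
theorem eigenvalues₀_max_lt_one_of_weightedRowDominance (Λ : Matrix (Fin N) (Fin N) ℝ)
    (hΛ0 : ∀ n m, 0 ≤ Λ n m) (d w : Fin N → ℝ) (hw : ∀ n, 0 < w n)
    (hdom : ∀ n : Fin N, ∑ m, Λ n m * w m < d n * w n)
    (S₀ : Matrix (Fin N) (Fin N) ℝ) (hS₀ : S₀.IsHermitian)
    (hS : ∀ n m, S₀ n m = Λ n m / (Real.sqrt (d n) * Real.sqrt (d m)))
    (s : Fin N → ℝ) {μ : ℝ} (hμ : 0 ≤ μ) (hn : 1 ≤ Fintype.card (Fin N)) :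
    (isHermitian_rankOneDownshift hS₀ s μ).eigenvalues₀ (Fin.castLE hn 0) < 1 := by
  have hd : ∀ n, 0 < d n := fun n => by
    have h1 : 0 ≤ ∑ m, Λ n m * w m := Finset.sum_nonneg fun m _ => mul_nonneg (hΛ0 n m) (hw m).le
    have h2 : 0 < d n * w n := h1.trans_lt (hdom n)
    exact (mul_pos_iff_of_pos_right (hw n)).mp h2
  have hN : 0 < N := by simp only [Fintype.card_fin] at hn; omega
  have hne : (Finset.univ : Finset (Fin N)).Nonempty :=
    Finset.univ_nonempty_iff.mpr (Fin.pos_iff_nonempty.mp hN)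
  obtain ⟨n₀, -, hmax⟩ :=
    Finset.exists_max_image Finset.univ (fun n => (∑ m, Λ n m * w m) / (d n * w n)) hne
  set θ := (∑ m, Λ n₀ m * w m) / (d n₀ * w n₀) with hθ
  have hdw : ∀ n, 0 < d n * w n := fun n => mul_pos (hd n) (hw n)
  have hθ1 : θ < 1 := (div_lt_one (hdw n₀)).mpr (hdom n₀)
  have hrowΛ : ∀ n, ∑ m, Λ n m * w m ≤ θ * (d n * w n) := fun n => by
    have := hmax n (Finset.mem_univ n)
    rwa [div_le_iff₀ (hdw n)] at this
  refine lt_of_le_of_lt ?_ hθ1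
  refine eigenvalues₀_max_rankOneDownshift_le_of_weightedRowSum_le hS₀
    (fun n m => by rw [hS]; exact div_nonneg (hΛ0 n m) (by positivity))
    (p := fun n => Real.sqrt (d n) * w n) (fun n => mul_pos (Real.sqrt_pos.mpr (hd n)) (hw n)) ?_ s hμ hn
  intro n
  have hsq : ∀ m, Real.sqrt (d m) ≠ 0 := fun m => (Real.sqrt_pos.mpr (hd m)).ne'
  have e : ∑ m, S₀ n m * (Real.sqrt (d m) * w m) = (∑ m, Λ n m * w m) / Real.sqrt (d n) := by
    rw [Finset.sum_div]
    refine Finset.sum_congr rfl fun m _ => ?_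
    rw [hS, ← mul_assoc, div_mul_eq_mul_div, mul_div_mul_right _ _ (hsq m), mul_div_right_comm]
  rw [e, div_le_iff₀ (Real.sqrt_pos.mpr (hd n))]
  calc ∑ m, Λ n m * w m ≤ θ * (d n * w n) := hrowΛ n
    _ = θ * (Real.sqrt (d n) * w n) * Real.sqrt (d n) := by
        have h := Real.mul_self_sqrt (hd n).le
        calc θ * (d n * w n) = θ * (Real.sqrt (d n) * Real.sqrt (d n)) * w n := by rw [h]; ring
          _ = _ := by ring

end Weighted

/-! ### Row tails and the two row conditions for the weight `(1, v, v, …)` -/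

section Rows

/-- **Toeplitz rows: head plus the ROW tail.** `Σ_{m<N} λ(|n−m|) ≤ λ(0) + 2Σ_{k=1}^{n} λ(k) + T_n`
whenever every partial sum of `λ(n+1), λ(n+2), …` is `≤ T_n` and `λ ≥ 0`: the entries left of the
diagonal are `λ(n), …, λ(0)`, those right of it are `λ(1), λ(2), …`, of which the first `n` are paid
by the second copy of the head and the rest by `T_n`. [cite: AllenDynes1975, Eqs. (9)–(12)] -/
theorem sum_range_toeplitz_le_tail {lam : ℕ → ℝ} (hlam : ∀ k, 0 ≤ lam k) (n : ℕ) {Tn : ℝ}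
    (hT : ∀ M, ∑ k ∈ Finset.range M, lam (k + n + 1) ≤ Tn) (N : ℕ) :
    ∑ m ∈ Finset.range N, lam (Nat.dist n m) ≤
      lam 0 + 2 * (∑ k ∈ Finset.range n, lam (k + 1)) + Tn := by
  classical
  have hT0 : 0 ≤ Tn := le_trans (by simp) (hT 0)
  have hhead : 0 ≤ ∑ k ∈ Finset.range n, lam (k + 1) := Finset.sum_nonneg fun k _ => hlam _
  -- any partial sum of λ(1), λ(2), … is ≤ head + row tail
  have hpart : ∀ M, ∑ j ∈ Finset.range M, lam (j + 1) ≤ (∑ k ∈ Finset.range n, lam (k + 1)) + Tn := by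
    intro M
    rcases le_or_gt M n with hM | hM
    · calc ∑ j ∈ Finset.range M, lam (j + 1) ≤ ∑ k ∈ Finset.range n, lam (k + 1) :=
            Finset.sum_le_sum_of_subset_of_nonneg (Finset.range_mono hM) fun k _ _ => hlam _
        _ ≤ _ := le_add_of_nonneg_right hT0
    · obtain ⟨r, rfl⟩ := Nat.exists_eq_add_of_le hM.le
      rw [Finset.sum_range_add]
      refine add_le_add le_rfl ((Finset.sum_congr rfl fun x _ => ?_).trans_le (hT r))
      congr 1; omega
  rw [← Finset.sum_filter_add_sum_filter_not (Finset.range N) (fun m => m ≤ n)]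
  -- m ≤ n : injective into range (n+1) with value λ(n−m)
  have hleft : ∑ m ∈ (Finset.range N).filter (fun m => m ≤ n), lam (Nat.dist n m) ≤
      lam 0 + ∑ k ∈ Finset.range n, lam (k + 1) := by
    have h2 : ∑ m ∈ (Finset.range N).filter (fun m => m ≤ n), lam (Nat.dist n m) ≤
        ∑ k ∈ Finset.range (n + 1), lam k := by
      have hi : Set.InjOn (fun m => n - m) ↑((Finset.range N).filter (fun m => m ≤ n)) := by
        intro a ha b hb hab
        simp only [Finset.coe_filter, Finset.mem_range, Set.mem_setOf_eq] at ha hb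
        have : n - a = n - b := hab
        omega
      calc ∑ m ∈ (Finset.range N).filter (fun m => m ≤ n), lam (Nat.dist n m)
          = ∑ m ∈ (Finset.range N).filter (fun m => m ≤ n), lam (n - m) :=
            Finset.sum_congr rfl fun m hm => by
              simp only [Finset.mem_filter] at hm; rw [Nat.dist_eq_sub_of_le_right hm.2]
        _ = ∑ j ∈ ((Finset.range N).filter (fun m => m ≤ n)).image (fun m => n - m), lam j :=
            (Finset.sum_image hi).symm
        _ ≤ ∑ k ∈ Finset.range (n + 1), lam k :=
            Finset.sum_le_sum_of_subset_of_nonneg (Finset.image_subset_iff.mpr fun r hr => by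
              simp only [Finset.mem_filter, Finset.mem_range] at hr ⊢; omega) fun k _ _ => hlam k
    rw [Finset.sum_range_succ'] at h2
    linarith
  -- m > n : value λ(m−n) = λ((m−n−1)+1), injective into range (N−n−1) ⊆ partial sums of λ(·+1)
  have hright : ∑ m ∈ (Finset.range N).filter (fun m => ¬ m ≤ n), lam (Nat.dist n m) ≤
      (∑ k ∈ Finset.range n, lam (k + 1)) + Tn := by
    have hi : Set.InjOn (fun m => m - n - 1) ↑((Finset.range N).filter (fun m => ¬ m ≤ n)) := by
      intro a ha b hb hab
      simp only [Finset.coe_filter, Finset.mem_range, Set.mem_setOf_eq] at ha hb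
      have : a - n - 1 = b - n - 1 := hab
      omega
    calc ∑ m ∈ (Finset.range N).filter (fun m => ¬ m ≤ n), lam (Nat.dist n m)
        = ∑ m ∈ (Finset.range N).filter (fun m => ¬ m ≤ n), lam ((m - n - 1) + 1) :=
          Finset.sum_congr rfl fun m hm => by
            simp only [Finset.mem_filter, not_le] at hm
            rw [Nat.dist_eq_sub_of_le hm.2.le]; congr 1; omega
      _ = ∑ j ∈ ((Finset.range N).filter (fun m => ¬ m ≤ n)).image (fun m => m - n - 1), lam (j + 1) :=
          (Finset.sum_image (f := fun j => lam (j + 1)) hi).symm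
      _ ≤ ∑ j ∈ Finset.range (N - n - 1), lam (j + 1) :=
          Finset.sum_le_sum_of_subset_of_nonneg (Finset.image_subset_iff.mpr fun r hr => by
            simp only [Finset.mem_filter, Finset.mem_range] at hr ⊢; omega) fun k _ _ => hlam _
      _ ≤ _ := hpart _
  linarith

/-- **Row `0` with weight `(1, v, v, …)`**: `Σ_{m<N} Λ_{0m} w_m = λ(0) + λ(1) + v Σ_{1≤m<N} (λ(m) + λ(m+1))
< d_0 = d_0 w_0` as soon as `λ(1) + v(τ₁ + τ₂) < 1`, where `τ₁`, `τ₂` bound the partial sums of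
`λ(1), λ(2), …` resp. `λ(2), λ(3), …` and `d_0 ≥ 1 + λ(0)`. [cite: AllenDynes1975, Eqs. (9)–(12)] -/
theorem weightedRow_zero_lt {lam : ℕ → ℝ} {τ₁ τ₂ v d0 : ℝ} (hv : 0 ≤ v)
    (hτ₁ : ∀ M, ∑ k ∈ Finset.range M, lam (k + 1) ≤ τ₁)
    (hτ₂ : ∀ M, ∑ k ∈ Finset.range M, lam (k + 2) ≤ τ₂)
    (h0 : lam 1 + v * (τ₁ + τ₂) < 1) (hd : 1 + lam 0 ≤ d0) (N' : ℕ) :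
    ∑ m ∈ Finset.range (N' + 1),
      (lam (Nat.dist 0 m) + lam (0 + m + 1)) * (if m = 0 then (1:ℝ) else v) < d0 * 1 := by
  rw [Finset.sum_range_succ']
  have e1 : ∀ k : ℕ, (lam (Nat.dist 0 (k + 1)) + lam (0 + (k + 1) + 1)) * (if k + 1 = 0 then (1:ℝ) else v)
      = (lam (k + 1) + lam (k + 2)) * v := fun k => by
    rw [if_neg (Nat.succ_ne_zero k), Nat.dist_zero_left, Nat.zero_add]
  have e0 : (lam (Nat.dist 0 0) + lam (0 + 0 + 1)) * (if (0:ℕ) = 0 then (1:ℝ) else v) = lam 0 + lam 1 := by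
    rw [if_pos rfl, Nat.dist_zero_left]; norm_num
  rw [Finset.sum_congr rfl fun k _ => e1 k, e0]
  have h1 : ∑ k ∈ Finset.range N', (lam (k + 1) + lam (k + 2)) * v ≤ v * (τ₁ + τ₂) := by
    rw [← Finset.sum_mul, mul_comm, Finset.sum_add_distrib]
    exact mul_le_mul_of_nonneg_left (add_le_add (hτ₁ N') (hτ₂ N')) hv
  linarith

/-- **Rows `n ≥ 1` with weight `(1, v, v, …)`**: `Σ_{m<N} Λ_{nm} w_m = (1−v)Λ_{n0} + v Σ_{m<N} Λ_{nm}
< v d_n = d_n w_n` as soon as `(1−v)(λ(n)+λ(n+1)) + 2v T_n < 3v`, `T_n` a bound of the row tail (partial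
sums of `λ(n+1), λ(n+2), …`), `0 < v`, full-line weights `d_n ≥ 2n+1 + λ(0) + 2Σ_{k≤n} λ(k)`.
[cite: AllenDynes1975, Eqs. (9)–(12)] -/
theorem weightedRow_succ_lt {lam : ℕ → ℝ} (hlam : ∀ k, 0 ≤ lam k) {v Tn dn : ℝ} (hv : 0 < v)
    {n : ℕ} (hn : 1 ≤ n)
    (hT : ∀ M, ∑ k ∈ Finset.range M, lam (k + n + 1) ≤ Tn)
    (h1 : (1 - v) * (lam n + lam (n + 1)) + 2 * v * Tn < 3 * v)
    (hd : (2 * (n : ℝ) + 1) + lam 0 + 2 * ∑ k ∈ Finset.range n, lam (k + 1) ≤ dn) (N' : ℕ) :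
    ∑ m ∈ Finset.range (N' + 1),
      (lam (Nat.dist n m) + lam (n + m + 1)) * (if m = 0 then (1:ℝ) else v) < dn * v := by
  set F : ℕ → ℝ := fun m => lam (Nat.dist n m) + lam (n + m + 1) with hF
  have hF0 : F 0 = lam n + lam (n + 1) := by simp [hF, Nat.dist_zero_right]
  have hFnn : ∀ m, 0 ≤ F m := fun m => add_nonneg (hlam _) (hlam _)
  -- total row sum bound: Σ_{m<N'+1} F m ≤ λ0 + 2 head + 2 Tn
  have htoe := sum_range_toeplitz_le_tail hlam n hT (N' + 1)
  have hhan : ∑ m ∈ Finset.range (N' + 1), lam (n + m + 1) ≤ Tn :=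
    (Finset.sum_congr rfl fun m _ => by congr 1; omega).trans_le (hT (N' + 1))
  have htot : ∑ m ∈ Finset.range (N' + 1), F m ≤
      lam 0 + 2 * (∑ k ∈ Finset.range n, lam (k + 1)) + 2 * Tn := by
    simp only [hF]; rw [Finset.sum_add_distrib]; linarith
  -- split off m = 0
  have hsplit : ∑ m ∈ Finset.range (N' + 1), F m * (if m = 0 then (1:ℝ) else v) =
      F 0 + v * ∑ m ∈ Finset.range N', F (m + 1) := by
    rw [Finset.sum_range_succ']
    simp only [Nat.succ_ne_zero, ↓reduceIte, mul_one, Finset.mul_sum]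
    rw [add_comm]; congr 1; exact Finset.sum_congr rfl fun m _ => mul_comm _ _
  have hshift : ∑ m ∈ Finset.range N', F (m + 1) = (∑ m ∈ Finset.range (N' + 1), F m) - F 0 := by
    rw [Finset.sum_range_succ']; ring
  have hn1 : (1 : ℝ) ≤ n := by exact_mod_cast hn
  have key : ∑ m ∈ Finset.range (N' + 1), F m * (if m = 0 then (1:ℝ) else v) < dn * v := by
    rw [hsplit, hshift, hF0]
    have hhead : 0 ≤ ∑ k ∈ Finset.range n, lam (k + 1) := Finset.sum_nonneg fun k _ => hlam _
    nlinarith [htot, hd, h1, hv, hFnn 0, hF0]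
  simpa only [hF] using key

end Rows

/-! ### The row tails at temperature `T` -/

section Tails

variable {κ : Type*}

/-- Partial sums of `1/k²` from `k = 2` are below `π²/6 − 1` (non-negative series, `hasSum_zeta_two`).
[folklore] -/
private theorem sum_range_inv_add_two_sq_le (M : ℕ) :
    ∑ k ∈ Finset.range M, 1 / ((k : ℝ) + 2) ^ 2 ≤ π ^ 2 / 6 - 1 := by
  have h := sum_le_hasSum (Finset.range (M + 2)) (fun n _ => by positivity) hasSum_zeta_two
  rw [Finset.sum_range_succ', Finset.sum_range_succ'] at h
  have e : ∀ k : ℕ, ((k + 1 + 1 : ℕ) : ℝ) = (k : ℝ) + 2 := fun k => by push_cast; ring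
  simp only [e] at h
  norm_num at h
  simp only [one_div] at h ⊢
  linarith

/-- **Row tails**: for `n ≥ 1`, `Σ_{k<M} λ(k+n+1; T) ≤ A/(24T²) − A/(4π²T²) = (A/(2πT)²)(π²/6 − 1)`
(each term is `≤ A/(2πT(k+n+1))² ≤ A/(2πT)² (k+2)^{-2}`). [cite: AllenDynes1975, Eqs. (9)–(12)] -/
theorem sum_matsubaraCoupling_tail_le (s : Finset κ) {l : κ → ℝ} (ω : κ → ℝ)
    (hl : ∀ i ∈ s, 0 ≤ l i) {T : ℝ} (hT : 0 < T) {n : ℕ} (hn : 1 ≤ n) (M : ℕ) :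
    ∑ k ∈ Finset.range M, ∑ i ∈ s, l i * (ω i ^ 2 / (ω i ^ 2 + (2 * π * T * (k + n + 1 : ℕ)) ^ 2)) ≤
      (∑ i ∈ s, l i * ω i ^ 2) / (2 * π * T) ^ 2 * (π ^ 2 / 6 - 1) := by
  set A := ∑ i ∈ s, l i * ω i ^ 2 with hA
  have hA0 : 0 ≤ A := Finset.sum_nonneg fun i hi => mul_nonneg (hl i hi) (sq_nonneg _)
  have hstep : ∀ k ∈ Finset.range M,
      ∑ i ∈ s, l i * (ω i ^ 2 / (ω i ^ 2 + (2 * π * T * (k + n + 1 : ℕ)) ^ 2)) ≤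
        A / (2 * π * T) ^ 2 * (1 / ((k : ℝ) + 2) ^ 2) := fun k _ => by
    have h := matsubaraCouplingDiscrete_le s ω hl hT (k := k + n + 1) (by omega)
    refine h.trans ?_
    have hk2 : (k : ℝ) + 2 ≤ ((k + n + 1 : ℕ) : ℝ) := by push_cast; linarith [(show (1:ℝ) ≤ n by exact_mod_cast hn)]
    have hpos : 0 < (k : ℝ) + 2 := by positivity
    rw [show (2 * π * T * ((k + n + 1 : ℕ) : ℝ)) ^ 2 = (2 * π * T) ^ 2 * ((k + n + 1 : ℕ) : ℝ) ^ 2 by ring,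
      ← div_div, mul_one_div]
    refine div_le_div_of_nonneg_left (div_nonneg hA0 (by positivity)) (by positivity) ?_
    exact pow_le_pow_left₀ hpos.le hk2 2
  calc _ ≤ ∑ k ∈ Finset.range M, A / (2 * π * T) ^ 2 * (1 / ((k : ℝ) + 2) ^ 2) := Finset.sum_le_sum hstep
    _ = A / (2 * π * T) ^ 2 * ∑ k ∈ Finset.range M, 1 / ((k : ℝ) + 2) ^ 2 := by rw [Finset.mul_sum]
    _ ≤ A / (2 * π * T) ^ 2 * (π ^ 2 / 6 - 1) :=
        mul_le_mul_of_nonneg_left (sum_range_inv_add_two_sq_le M) (by positivity)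

end Tails

/-! ### Assembly -/

section Assembly

variable {κ : Type*} {N : ℕ}

/-- The numerical heart: with `B = A/(2πT)²`, `τ₁ = A/(24T²)`, `τ₂ = τ₁ − B` and `49T² > 2A`, both row
conditions of the weight `(1, 4/15, 4/15, …)` hold: `B + (4/15)(τ₁+τ₂) < 1` and
`(11/15)(5/4)B + (8/15)τ₂ < 4/5` (uses `π > 3.141592`). [folklore] -/
private theorem row_constants {A T : ℝ} (hA0 : 0 ≤ A) (hT : 0 < T) (hA : 2 * A < 49 * T ^ 2) :
    A / (2 * π * T) ^ 2 + 4 / 15 * (A / (24 * T ^ 2) + (A / (24 * T ^ 2) - A / (2 * π * T) ^ 2)) < 1 ∧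
    (1 - 4 / 15) * (5 / 4 * (A / (2 * π * T) ^ 2)) +
      2 * (4 / 15) * (A / (24 * T ^ 2) - A / (2 * π * T) ^ 2) < 3 * (4 / 15) := by
  have hπ := Real.pi_gt_d6
  have hT2 : 0 < T ^ 2 := by positivity
  set a := A / T ^ 2 with ha
  have ha0 : 0 ≤ a := div_nonneg hA0 hT2.le
  have ha1 : a < 49 / 2 := by rw [ha, div_lt_iff₀ hT2]; linarith
  have hπ2 : (24674 / 625 : ℝ) < 4 * π ^ 2 := by nlinarith
  have hB : A / (2 * π * T) ^ 2 = a / (4 * π ^ 2) := by rw [ha]; field_simp; ring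
  have hτ : A / (24 * T ^ 2) = a / 24 := by rw [ha]; field_simp
  have hX : a / (4 * π ^ 2) ≤ a * (625 / 24674) := by
    rw [div_le_iff₀ (by positivity)]
    nlinarith [mul_nonneg ha0 (sub_nonneg.mpr hπ2.le)]
  have hXnn : 0 ≤ a / (4 * π ^ 2) := by positivity
  rw [hB, hτ]
  constructor
  · linarith
  · linarith

/-- **The sharper ceiling at one temperature (full-line `Z` convention).** For a discrete Eliashberg
function `(λ_i ≥ 0, ω_i)`, a temperature with `49T² > 2A` (`A = Σ_i λ_i ω_i²`), any cutoff `N`, any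
`μ ≥ 0` and weights `d_n ≥ 2n+1 + λ(0) + 2Σ_{k=1}^{n} λ(k)`, the top eigenvalue of the symmetrised
linearised isotropic Eliashberg kernel is `< 1`. [cite: AllenDynes1975, Eqs. (9)–(12)] -/
theorem eliashbergTopEigenvalue_lt_one_sharp (s : Finset κ) (l ω : κ → ℝ) (hl : ∀ i ∈ s, 0 ≤ l i)
    {T : ℝ} (hT : 0 < T) (hA : 2 * ∑ i ∈ s, l i * ω i ^ 2 < 49 * T ^ 2)
    (lam : ℕ → ℝ) (hlam : ∀ k : ℕ, lam k = ∑ i ∈ s, l i * (ω i ^ 2 / (ω i ^ 2 + (2 * π * T * k) ^ 2)))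
    (Λ : Matrix (Fin N) (Fin N) ℝ)
    (hΛ : ∀ n m : Fin N, Λ n m = lam (Nat.dist n m) + lam ((n : ℕ) + m + 1))
    (d : Fin N → ℝ)
    (hd : ∀ n : Fin N, (2 * ((n : ℕ) : ℝ) + 1) + lam 0 + 2 * ∑ k ∈ Finset.range n, lam (k + 1) ≤ d n)
    (S₀ : Matrix (Fin N) (Fin N) ℝ) (hS₀ : S₀.IsHermitian)
    (hS : ∀ n m, S₀ n m = Λ n m / (Real.sqrt (d n) * Real.sqrt (d m)))
    (sv : Fin N → ℝ) {μ : ℝ} (hμ : 0 ≤ μ) (hn : 1 ≤ Fintype.card (Fin N)) :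
    (isHermitian_rankOneDownshift hS₀ sv μ).eigenvalues₀ (Fin.castLE hn 0) < 1 := by
  set A := ∑ i ∈ s, l i * ω i ^ 2 with hAdef
  have hA0 : 0 ≤ A := Finset.sum_nonneg fun i hi => mul_nonneg (hl i hi) (sq_nonneg _)
  have hlam0 : ∀ k, 0 ≤ lam k := fun k => by
    rw [hlam]; exact matsubaraCouplingDiscrete_nonneg s ω hl T k
  -- single-entry bound λ(k) ≤ B/k² ≤ B (k ≥ 1) and ≤ B/4 (k ≥ 2)
  set B := A / (2 * π * T) ^ 2 with hBdef
  have hB0 : 0 ≤ B := by positivity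
  have hlamk : ∀ k : ℕ, 1 ≤ k → lam k ≤ B / (k : ℝ) ^ 2 := fun k hk => by
    rw [hlam]
    refine (matsubaraCouplingDiscrete_le s ω hl hT hk).trans (le_of_eq ?_)
    rw [hBdef, hAdef]; field_simp
  have hlam1 : lam 1 ≤ B := by simpa using hlamk 1 le_rfl
  have hlam_ge1 : ∀ k : ℕ, 1 ≤ k → lam k ≤ B := fun k hk =>
    (hlamk k hk).trans (div_le_self hB0 (by exact_mod_cast Nat.one_le_pow 2 k hk))
  have hlam_ge2 : ∀ k : ℕ, 2 ≤ k → lam k ≤ B / 4 := fun k hk =>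
    (hlamk k (by omega)).trans (div_le_div_of_nonneg_left hB0 (by norm_num)
      (by have : (2:ℝ) ≤ k := by exact_mod_cast hk
          nlinarith))
  -- tails
  set τ₁ := A / (24 * T ^ 2) with hτ₁def
  set τ₂ := A / (24 * T ^ 2) - A / (2 * π * T) ^ 2 with hτ₂def
  have hτ₁ : ∀ M, ∑ k ∈ Finset.range M, lam (k + 1) ≤ τ₁ := fun M => by
    refine le_of_eq_of_le (Finset.sum_congr rfl fun k _ => ?_) (sum_matsubaraCoupling_succ_le s ω hl hT M)
    rw [hlam]
  have hτn : ∀ n : ℕ, 1 ≤ n → ∀ M, ∑ k ∈ Finset.range M, lam (k + n + 1) ≤ τ₂ := fun n hn1 M => by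
    have h := sum_matsubaraCoupling_tail_le s ω hl hT hn1 M
    have e : A / (2 * π * T) ^ 2 * (π ^ 2 / 6 - 1) = τ₂ := by
      rw [hτ₂def]; field_simp; ring
    rw [e] at h
    refine le_of_eq_of_le (Finset.sum_congr rfl fun k _ => ?_) h
    rw [hlam]
  have hτ₂ : ∀ M, ∑ k ∈ Finset.range M, lam (k + 2) ≤ τ₂ := fun M => by
    simpa using hτn 1 le_rfl M
  obtain ⟨c0, c1⟩ := row_constants hA0 hT hA
  -- the weight
  set w : Fin N → ℝ := fun m => if (m : ℕ) = 0 then 1 else 4 / 15 with hw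
  have hwpos : ∀ m, 0 < w m := fun m => by simp only [hw]; split_ifs <;> norm_num
  have hN : 0 < N := by simp only [Fintype.card_fin] at hn; omega
  obtain ⟨N', rfl⟩ : ∃ N', N = N' + 1 := ⟨N - 1, by omega⟩
  refine eigenvalues₀_max_lt_one_of_weightedRowDominance Λ
    (fun n m => by rw [hΛ]; exact add_nonneg (hlam0 _) (hlam0 _)) d w hwpos ?_ S₀ hS₀ hS sv hμ hn
  intro n
  rw [Finset.sum_congr rfl fun m _ => by rw [hΛ n m],
    Fin.sum_univ_eq_sum_range
      (fun m => (lam (Nat.dist n m) + lam ((n : ℕ) + m + 1)) * (if m = 0 then (1:ℝ) else 4 / 15)) (N' + 1)]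
  rcases Nat.eq_zero_or_pos (n : ℕ) with hn0 | hnpos
  · -- row 0
    have hw0 : w n = 1 := by simp only [hw]; rw [if_pos hn0]
    rw [hw0, hn0]
    have hd0 : 1 + lam 0 ≤ d n := by have := hd n; rw [hn0] at this; simpa using this
    have h0 : lam 1 + 4 / 15 * (τ₁ + τ₂) < 1 := by linarith
    exact weightedRow_zero_lt (by norm_num) hτ₁ hτ₂ h0 hd0 N'
  · -- rows n ≥ 1
    have hwn : w n = 4 / 15 := by simp only [hw]; rw [if_neg (Nat.pos_iff_ne_zero.mp hnpos)]
    rw [hwn]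
    have hΛn0 : lam n + lam ((n : ℕ) + 1) ≤ 5 / 4 * B := by
      have h1 := hlam_ge1 n hnpos
      have h2 := hlam_ge2 ((n : ℕ) + 1) (by omega)
      linarith
    have h1 : (1 - 4 / 15) * (lam n + lam ((n : ℕ) + 1)) + 2 * (4 / 15) * τ₂ < 3 * (4 / 15) := by
      nlinarith
    exact weightedRow_succ_lt hlam0 (by norm_num) hnpos (hτn n hnpos) h1 (hd n) N'

/-- **`T_c ≤ (2λ⟨ω²⟩/49)^{1/2} = 0.2020 (λ⟨ω²⟩)^{1/2}` for the linearised isotropic Migdal–Eliashberg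
equations (full-line `Z`)**: threshold form, for any criticality indicator `ρ` that is, at every
`T > (2A/49)^{1/2}`, the top eigenvalue of such a kernel (any cutoff `N(T)`, any `μ(T) ≥ 0`). The
Allen–Dynes asymptote is `0.1827 (λ⟨ω²⟩)^{1/2}` (ratio `1.106`).
[cite: AllenDynes1975, Eqs. (9)–(12) and (26)] [cite: KiesslingAltshulerYuzbashyan2025II, Thm. 6] -/
theorem eliashbergTc_le_sqrt_sharp {κ : Type*} (s : Finset κ) (l ω : κ → ℝ) (hl : ∀ i ∈ s, 0 ≤ l i)
    (ρ : ℝ → ℝ)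
    (hρ : ∀ T : ℝ, Real.sqrt (2 * (∑ i ∈ s, l i * ω i ^ 2) / 49) < T →
      ∃ (N : ℕ) (hn : 1 ≤ Fintype.card (Fin N)) (lam : ℕ → ℝ) (Λ : Matrix (Fin N) (Fin N) ℝ)
        (d : Fin N → ℝ) (S₀ : Matrix (Fin N) (Fin N) ℝ) (hS₀ : S₀.IsHermitian) (sv : Fin N → ℝ) (μ : ℝ),
        (∀ k : ℕ, lam k = ∑ i ∈ s, l i * (ω i ^ 2 / (ω i ^ 2 + (2 * π * T * k) ^ 2))) ∧
        (∀ n m : Fin N, Λ n m = lam (Nat.dist n m) + lam ((n : ℕ) + m + 1)) ∧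
        (∀ n : Fin N, (2 * ((n : ℕ) : ℝ) + 1) + lam 0 + 2 * ∑ k ∈ Finset.range n, lam (k + 1) ≤ d n) ∧
        (∀ n m, S₀ n m = Λ n m / (Real.sqrt (d n) * Real.sqrt (d m))) ∧ 0 ≤ μ ∧
        ρ T = (isHermitian_rankOneDownshift hS₀ sv μ).eigenvalues₀ (Fin.castLE hn 0)) :
    BddAbove {T : ℝ | 0 < T ∧ 1 ≤ ρ T} ∧
      sSup {T : ℝ | 0 < T ∧ 1 ≤ ρ T} ≤ Real.sqrt (2 * (∑ i ∈ s, l i * ω i ^ 2) / 49) := by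
  refine sSup_superlevel_le_of_lt_one (Real.sqrt_nonneg _) fun T hT => ?_
  have hTpos : 0 < T := lt_of_le_of_lt (Real.sqrt_nonneg _) hT
  obtain ⟨N, hn, lam, Λ, d, S₀, hS₀, sv, μ, hlam, hΛ, hd, hS, hμ, hρT⟩ := hρ T hT
  rw [hρT]
  have hA : 2 * ∑ i ∈ s, l i * ω i ^ 2 < 49 * T ^ 2 := by
    have := (Real.sqrt_lt' hTpos).mp hT
    linarith
  exact eliashbergTopEigenvalue_lt_one_sharp s l ω hl hTpos hA lam hlam Λ hΛ d hd S₀ hS₀ hS sv hμ hn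

end Assembly

end Literature.MathematicalPhysics.QuantumManyBody
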